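import Summits.FinalStateConjecture.FinalStateConjecture.Theses.ZeroEnergyKerrOrBomb
import Summits.FinalStateConjecture.FinalStateConjecture.Theorems.ZeroEnergyKerrOrBombHawkingExtensionIsKerrReductionCollar
import Summits.FinalStateConjecture.FinalStateConjecture.Theorems.ZeroEnergyKerrOrBombHawkingExtensionIsKerrHRDefiningFunction

/-!
# Crux `HawkingExtensionIsKerr` (stmt-FinalStateConjecture-17840) — strategist line `strategist-split`
# (the typed 2-way decomposition A ∧ B, NOT registered: the live skeleton stays `Lines/SketchIdeator2.lean`)

Crux-strategist unit `cstrat-stmt-FinalStateConjecture-17840-s1`, 2026-08-17.  This file records, in checkable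
form, the decomposition proposed in `STRATEGY-CENSUS.md` § Decomposition:

* `stub_degenerateHorizonTurnsSpacelike` — **A**, the analytic core of the degenerate exclusion; its
  statement is the live line's registered stub `stub_noCollar_of_definingFunction` (r7) verbatim (fully
  qualified), so a proof of either closes both;
* `stub_nondegenerateDock` — **B**, the crux with ONE extra hypothesis on its own collar field ("if `K`
  is null, locally tangent and degenerate on `𝓔⁺` then it turns spacelike near `𝓔⁺`"): the classical
  uniqueness content, CLOSED MODULO the four Literature facts by the sorry-free
  `nondegenerateDock_of_four_facts` below (the proof of `hawkingExtensionIsKerr_of_five_facts`, p144689,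
  with the pointwise hypothesis in place of the global fact `DegenerateVacuumHorizonNoCollar`);
* `HawkingExtensionIsKerr_of` — the crux decl BY NAME from the two stubs (glue = A ∘ `stub_hr_assembly`,
  p151777, fed into B's extra hypothesis).

`sorry` occurs only in the two stubs.  The same three theorems with Theses-free inlined bodies are the
strategist's evidence file `ZeroEnergyKerrOrBombHawkingExtensionIsKerrSplit.lean` on the crux item (lean check
rc 0, 0 sorries), to be landed by a prover seat as
`Theorems/ZeroEnergyKerrOrBombHawkingExtensionIsKerrSplit.lean --supports stmt-FinalStateConjecture-17840`; the
route-level split (`route edit --split HawkingExtensionIsKerr --into children.json --glue-by …hawkingExtensionIsKerr_of_subs`)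
is the tenure planner's one-liner (a strategist seat is bounced `split: final cycle only`).
-/

noncomputable section

set_option linter.dupNamespace false

namespace Summit.FinalStateConjecture.FinalStateConjecture.Cruxes.HawkingExtensionIsKerr.StrategistSplit

open Set Function Literature.Geometry.Lorentzian
open Summit.FinalStateConjecture.FinalStateConjecture.Theorems.HawkingExtensionIsKerr.SketchIdeator2
open scoped Manifold ContDiff Topology

/-! ## The two stubs -/

/-- **A — a degenerate generator Killing field of a smooth vacuum `I⁺`-regular horizon with spherical
sections turns spacelike near `𝓔⁺`** (= `SketchIdeator2.stub_noCollar_of_definingFunction`, r7, verbatim;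
Kunduri–Lucietti 2013 (17)–(18) + divergence theorem + Gauss–Bonnet on the S² section). -/
theorem stub_degenerateHorizonTurnsSpacelike :
    ∀ (𝓑 : Literature.Geometry.Lorentzian.StationaryAFBlackHole.{0}) [𝓑.metric.HasLeviCivita], 𝓑.metric.toPseudoRiemannianMetric.IsRicciFlat → 𝓑.IsIPlusRegular → IsConnected 𝓑.horizon → SimplyConnectedSpace 𝓑.doc → ∀ (U : Set 𝓑.carrier) (K : Π x : 𝓑.carrier, TangentSpace (𝓡 4) x), IsOpen U → 𝓑.horizon ⊆ U → Literature.Geometry.Lorentzian.PseudoRiemannianMetric.IsKillingFieldOn 𝓑.metric.toPseudoRiemannianMetric K U → (∀ x ∈ U, VectorField.mlieBracket (𝓡 4) 𝓑.killing K x = 0) → (∀ p ∈ 𝓑.horizon, K p ≠ 0) → (∀ p ∈ 𝓑.horizon, 𝓑.metric.val p (K p) (K p) = 0) → (∀ p ∈ 𝓑.horizon, ∃ ε > (0 : ℝ), ∃ γ : ℝ → 𝓑.carrier, γ 0 = p ∧ IsMIntegralCurveOn γ K (Set.Ioo (-ε) ε) ∧ ∀ t ∈ Set.Ioo (-ε)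 ε, γ t ∈ 𝓑.horizon) → (∀ p ∈ 𝓑.horizon, 𝓑.metric.leviCivita K p (K p) = 0) → (∀ p ∈ 𝓑.horizon, ∃ W : Set 𝓑.carrier, IsOpen W ∧ p ∈ W ∧ W ⊆ U ∧ ∃ F : 𝓑.carrier → ℝ, ContMDiffOn (𝓡 4) 𝓘(ℝ, ℝ) ((⊤ : ℕ∞) : WithTop ℕ∞) F W ∧ (∀ x ∈ W, x ∈ 𝓑.horizon ↔ F x = 0) ∧ (∀ x ∈ W, x ∈ 𝓑.doc ↔ F x < 0) ∧ ∀ x ∈ W ∩ 𝓑.horizon, ∃ c : ℝ, c ≠ 0 ∧ ∀ w : TangentSpace (𝓡 4) x, mfderiv (𝓡 4) 𝓘(ℝ, ℝ) F x w = c * 𝓑.metric.val x (K x) w) → ∀ V : Set 𝓑.carrier, IsOpen V → 𝓑.horizon ⊆ V → ∃ x ∈ V ∩ 𝓑.doc, 0 < 𝓑.metric.val x (K x) (K x) := by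
  sorry

/-- **B — the non-degenerate dock**: the crux body with the no-collar property of its own collar field as
ONE extra hypothesis (inserted after the collar-timelike clause).  Closed modulo the four uniqueness facts:
`nondegenerateDock_of_four_facts`. -/
theorem stub_nondegenerateDock :
    ∀ (𝓑 : Literature.Geometry.Lorentzian.StationaryAFBlackHole.{0}) [𝓑.metric.HasLeviCivita] [Literature.Geometry.Lorentzian.Kerr.Facts], 𝓑.metric.toPseudoRiemannianMetric.IsRicciFlat → 𝓑.IsIPlusRegular → (∀ p : 𝓑.carrier, p ∈ 𝓑.metric.chronologicalFuture 𝓑.timeOrientation 𝓑.Mext) → (∀ p ∈ 𝓑.doc, 𝓑.killing p ≠ 0) → SimplyConnectedSpace 𝓑.doc → ∀ (U : Set 𝓑.carrier) (K : Π x : 𝓑.carrier, TangentSpace (𝓡 4) x), IsOpen U → 𝓑.horizon ⊆ U → IsConnected 𝓑.horizon → ContMDiffOn (𝓡 4) ((𝓡 4).prod 𝓘(ℝ, Literature.Geometry.Lorentzian.E4)) ((⊤ : ℕ∞) : WithTop ℕ∞) (fun x ↦ (Bundle.TotalSpace.mk' Literature.Geometry.Lorentzian.E4 x (K x) : TangentBundle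 (𝓡 4) 𝓑.carrier)) U → (∀ x ∈ U, ∀ v w : TangentSpace (𝓡 4) x, 𝓑.metric.val x (𝓑.metric.leviCivita K x v) w + 𝓑.metric.val x v (𝓑.metric.leviCivita K x w) = 0) → (∀ x ∈ U, VectorField.mlieBracket (𝓡 4) 𝓑.killing K x = 0) → (∀ p ∈ 𝓑.horizon, K p ≠ 0) → (∀ γ : ℝ → 𝓑.carrier, IsMIntegralCurve γ K → γ 0 ∈ 𝓑.horizon → ∀ t, γ t ∈ 𝓑.horizon) → (∀ x ∈ U ∩ 𝓑.doc, 𝓑.metric.val x (K x) (K x) < 0) → ((∀ p ∈ 𝓑.horizon, 𝓑.metric.val p (K p) (K p) = 0) → (∀ p ∈ 𝓑.horizon, ∃ ε > (0 : ℝ), ∃ γ : ℝ → 𝓑.carrier, γ 0 = p ∧ IsMIntegralCurveOn γ K (Set.Ioo (-ε) ε) ∧ ∀ t ∈ Set.Ioo (-ε) ε, γ t ∈ 𝓑.horizon) → (∀ p ∈ 𝓑.horizon, 𝓑.metric.leviCivita K p (K p) = 0) → ∀ V : Set 𝓑.carrier, IsOpen V → 𝓑.horizon ⊆ V → ∃ x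 ∈ V ∩ 𝓑.doc, 0 < 𝓑.metric.val x (K x) (K x)) → (∃ K' : Π x : 𝓑.carrier, TangentSpace (𝓡 4) x, ContMDiffOn (𝓡 4) ((𝓡 4).prod 𝓘(ℝ, Literature.Geometry.Lorentzian.E4)) ((⊤ : ℕ∞) : WithTop ℕ∞) (fun x ↦ (Bundle.TotalSpace.mk' Literature.Geometry.Lorentzian.E4 x (K' x) : TangentBundle (𝓡 4) 𝓑.carrier)) 𝓑.doc ∧ (∀ x ∈ 𝓑.doc, ∀ v w : TangentSpace (𝓡 4) x, 𝓑.metric.val x (𝓑.metric.leviCivita K' x v) w + 𝓑.metric.val x v (𝓑.metric.leviCivita K' x w) = 0) ∧ (∀ x ∈ 𝓑.doc, VectorField.mlieBracket (𝓡 4) 𝓑.killing K' x = 0) ∧ ∃ U' : Set 𝓑.carrier, IsOpen U' ∧ 𝓑.horizon ⊆ U' ∧ ∀ x ∈ U' ∩ 𝓑.doc, K' x = K x) → ∃ (M a : ℝ), Literature.Geometry.Lorentzian.Kerr.IsSubextremal M a ∧ ∃ Ψ : Literature.Geometry.Lorentzian.Kerr.exterior M a → 𝓑.carrier, Function.Injective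 Ψ ∧ Set.range Ψ = 𝓑.doc ∧ Literature.Geometry.Lorentzian.PseudoRiemannianMetric.IsIsometricImmersion (Literature.Geometry.Lorentzian.Kerr.smoothMetric M a (Literature.Geometry.Lorentzian.Kerr.rPlus M a)).toPseudoRiemannianMetric 𝓑.metric.toPseudoRiemannianMetric Ψ := by
  sorry

/-! ## B is closed modulo the four classical uniqueness facts (sorry-free) -/

/-- Collar surface gravity from the POINTWISE no-collar hypothesis (cf. `collarSurfaceGravity_of_collar`,
p144689): P5 nullity/tangency, the proved collar zeroth law (p144641), and `κ ≠ 0` from the hypothesis. -/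
theorem collarSurfaceGravity_of_noCollarHyp (𝓑 : StationaryAFBlackHole.{0})
    [𝓑.metric.HasLeviCivita] (hvac : 𝓑.metric.toPseudoRiemannianMetric.IsRicciFlat)
    (hfut : ∀ p : 𝓑.carrier, p ∈ 𝓑.metric.chronologicalFuture 𝓑.timeOrientation 𝓑.Mext)
    {U U' : Set 𝓑.carrier} {K K' : Π x : 𝓑.carrier, TangentSpace (𝓡 4) x}
    (hU : IsOpen U) (hHU : 𝓑.horizon ⊆ U) (hconn : IsConnected 𝓑.horizon)
    (hKon : 𝓑.metric.toPseudoRiemannianMetric.IsKillingFieldOn K U)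
    (hKne : ∀ p ∈ 𝓑.horizon, K p ≠ 0)
    (hKtl : ∀ x ∈ U ∩ 𝓑.doc, 𝓑.metric.val x (K x) (K x) < 0)
    (hNC : (∀ p ∈ 𝓑.horizon, 𝓑.metric.val p (K p) (K p) = 0) →
      (∀ p ∈ 𝓑.horizon, ∃ ε > (0 : ℝ), ∃ γ : ℝ → 𝓑.carrier, γ 0 = p ∧
        IsMIntegralCurveOn γ K (Set.Ioo (-ε) ε) ∧ ∀ t ∈ Set.Ioo (-ε) ε, γ t ∈ 𝓑.horizon) →
      (∀ p ∈ 𝓑.horizon, 𝓑.metric.leviCivita K p (K p) = 0) →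
      ∀ V : Set 𝓑.carrier, IsOpen V → 𝓑.horizon ⊆ V →
        ∃ x ∈ V ∩ 𝓑.doc, 0 < 𝓑.metric.val x (K x) (K x))
    (hU' : IsOpen U') (hHU' : 𝓑.horizon ⊆ U') (hK'K : ∀ x ∈ U' ∩ 𝓑.doc, K' x = K x)
    (hK'on : 𝓑.metric.toPseudoRiemannianMetric.IsKillingFieldOn K' 𝓑.doc)
    (hK'comp : ∀ x ∈ 𝓑.doc, ∃ δ : ℝ → 𝓑.carrier, IsMIntegralCurve δ K' ∧ δ 0 = x ∧
      ∀ t, δ t ∈ 𝓑.doc) :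
    ∃ κ : ℝ, κ ≠ 0 ∧ ∀ p ∈ 𝓑.horizon, 𝓑.metric.leviCivita K p (K p) = κ • K p := by
  have hNT := stub_collarNullTangent 𝓑 hfut U U' K K' hU hHU hKon hKtl hU' hHU' hK'K hK'on hK'comp
  have hnull : ∀ p ∈ 𝓑.horizon, 𝓑.metric.val p (K p) (K p) = 0 := fun p hp ↦ (hNT p hp).1
  have htan : ∀ p ∈ 𝓑.horizon, ∃ ε > (0 : ℝ), ∃ γ : ℝ → 𝓑.carrier, γ 0 = p ∧
      IsMIntegralCurveOn γ K (Set.Ioo (-ε) ε) ∧ ∀ t ∈ Set.Ioo (-ε) ε, γ t ∈ 𝓑.horizon :=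
    fun p hp ↦ (hNT p hp).2
  obtain ⟨κ, hκ⟩ := vacuumHorizonZerothLaw_of_collar 𝓑 hvac hconn hU hHU hKon hKne hnull hKtl
  refine ⟨κ, ?_, hκ⟩
  rintro rfl
  obtain ⟨x, hx, hpos⟩ := hNC hnull htan (fun p hp ↦ by rw [hκ p hp, zero_smul]) U hU hHU
  exact absurd (hKtl x hx) (not_lt.mpr hpos.le)

/-- **B from the four facts** (`SudarskyWald1993_staticity`, `ChruscielGalloway2010_docStaticUniqueness`,
`Chrusciel1997_docAxisymmetricCombination`, `ChruscielCostaHeusler2012_docAxisymmetricUniqueness`),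
sorry-free: the day their `_holds` land, `stub_nondegenerateDock` closes by `exact`. -/
theorem nondegenerateDock_of_four_facts :
    SudarskyWald1993_staticity → ChruscielGalloway2010_docStaticUniqueness → Chrusciel1997_docAxisymmetricCombination → ChruscielCostaHeusler2012_docAxisymmetricUniqueness → ∀ (𝓑 : Literature.Geometry.Lorentzian.StationaryAFBlackHole.{0}) [𝓑.metric.HasLeviCivita] [Literature.Geometry.Lorentzian.Kerr.Facts], 𝓑.metric.toPseudoRiemannianMetric.IsRicciFlat → 𝓑.IsIPlusRegular → (∀ p : 𝓑.carrier, p ∈ 𝓑.metric.chronologicalFuture 𝓑.timeOrientation 𝓑.Mext) → (∀ p ∈ 𝓑.doc, 𝓑.killing p ≠ 0) → SimplyConnectedSpace 𝓑.doc → ∀ (U : Set 𝓑.carrier) (K : Π x : 𝓑.carrier, TangentSpace (𝓡 4) x), IsOpen U → 𝓑.horizon ⊆ U → IsConnected 𝓑.horizon → ContMDiffOn (𝓡 4) ((𝓡 4).prod 𝓘(ℝ, Literature.Geometry.Lorentzian.E4)) ((⊤ : ℕ∞) : WithTop ℕ∞) (fun x ↦ (Bundle.TotalSpace.mk' Literature.Geometry.Lorentzian.E4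 x (K x) : TangentBundle (𝓡 4) 𝓑.carrier)) U → (∀ x ∈ U, ∀ v w : TangentSpace (𝓡 4) x, 𝓑.metric.val x (𝓑.metric.leviCivita K x v) w + 𝓑.metric.val x v (𝓑.metric.leviCivita K x w) = 0) → (∀ x ∈ U, VectorField.mlieBracket (𝓡 4) 𝓑.killing K x = 0) → (∀ p ∈ 𝓑.horizon, K p ≠ 0) → (∀ γ : ℝ → 𝓑.carrier, IsMIntegralCurve γ K → γ 0 ∈ 𝓑.horizon → ∀ t, γ t ∈ 𝓑.horizon) → (∀ x ∈ U ∩ 𝓑.doc, 𝓑.metric.val x (K x) (K x) < 0) → ((∀ p ∈ 𝓑.horizon, 𝓑.metric.val p (K p) (K p) = 0) → (∀ p ∈ 𝓑.horizon, ∃ ε > (0 : ℝ), ∃ γ : ℝ → 𝓑.carrier, γ 0 = p ∧ IsMIntegralCurveOn γ K (Set.Ioo (-ε) ε) ∧ ∀ t ∈ Set.Ioo (-ε) ε, γ t ∈ 𝓑.horizon) → (∀ p ∈ 𝓑.horizon, 𝓑.metric.leviCivita K p (K p) = 0) → ∀ V : Set 𝓑.carrier, IsOpen V → 𝓑.horizon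 ⊆ V → ∃ x ∈ V ∩ 𝓑.doc, 0 < 𝓑.metric.val x (K x) (K x)) → (∃ K' : Π x : 𝓑.carrier, TangentSpace (𝓡 4) x, ContMDiffOn (𝓡 4) ((𝓡 4).prod 𝓘(ℝ, Literature.Geometry.Lorentzian.E4)) ((⊤ : ℕ∞) : WithTop ℕ∞) (fun x ↦ (Bundle.TotalSpace.mk' Literature.Geometry.Lorentzian.E4 x (K' x) : TangentBundle (𝓡 4) 𝓑.carrier)) 𝓑.doc ∧ (∀ x ∈ 𝓑.doc, ∀ v w : TangentSpace (𝓡 4) x, 𝓑.metric.val x (𝓑.metric.leviCivita K' x v) w + 𝓑.metric.val x v (𝓑.metric.leviCivita K' x w) = 0) ∧ (∀ x ∈ 𝓑.doc, VectorField.mlieBracket (𝓡 4) 𝓑.killing K' x = 0) ∧ ∃ U' : Set 𝓑.carrier, IsOpen U' ∧ 𝓑.horizon ⊆ U' ∧ ∀ x ∈ U' ∩ 𝓑.doc, K' x = K x) → ∃ (M a : ℝ), Literature.Geometry.Lorentzian.Kerr.IsSubextremal M a ∧ ∃ Ψ : Literature.Geometry.Lorentzian.Kerr.exterior M a → 𝓑.carrier,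 Function.Injective Ψ ∧ Set.range Ψ = 𝓑.doc ∧ Literature.Geometry.Lorentzian.PseudoRiemannianMetric.IsIsometricImmersion (Literature.Geometry.Lorentzian.Kerr.smoothMetric M a (Literature.Geometry.Lorentzian.Kerr.rPlus M a)).toPseudoRiemannianMetric 𝓑.metric.toPseudoRiemannianMetric Ψ := by
  intro h₁ h₂ hCh97 hCCH 𝓑 _ _ hvac hreg hfut hT hsc U K hU hHU hconn hKs hKk hKc hKne hKtan hKtl hNC hext
  obtain ⟨K', hK's, hK'k, hK'c, U', hU', hHU', hK'K⟩ := hext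
  have hKon : 𝓑.metric.toPseudoRiemannianMetric.IsKillingFieldOn K U := ⟨hKs, hKk⟩
  have hK'on : 𝓑.metric.toPseudoRiemannianMetric.IsKillingFieldOn K' 𝓑.doc := ⟨hK's, hK'k⟩
  classical
  by_cases hrot : ∃ c : ℝ, ∀ x ∈ 𝓑.doc, K' x = c • 𝓑.killing x
  · obtain ⟨c, hc⟩ := hrot
    obtain ⟨κ, hκ, hκK⟩ := collarSurfaceGravity_of_noCollarHyp 𝓑 hvac hfut hU hHU hconn hKon hKne
      hKtl hNC hU' hHU' hK'K hK'on (docComplete_of_nonrotating 𝓑 hc)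
    obtain ⟨hc0, hTne, hTκ⟩ := stub_horizonKilling_of_nonrotating 𝓑 U U' K K' c κ hU hHU hKon hU'
      hHU' hK'K hc hKne hκK hconn.nonempty
    exact kerrConclusion_of_nonrotating h₁ h₂ 𝓑 hvac hreg hconn hTne
      ⟨c⁻¹ * κ, mul_ne_zero (inv_ne_zero hc0) hκ, hTκ⟩
  · obtain ⟨a, b, hb, hper, hax⟩ := hCh97 𝓑 hvac hreg hconn hsc K' hK'on hK'c hrot
    obtain ⟨κ, hκ, hκK⟩ := collarSurfaceGravity_of_noCollarHyp 𝓑 hvac hfut hU hHU hconn hKon hKne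
      hKtl hNC hU' hHU' hK'K hK'on (stub_docComplete_of_axial 𝓑 K' a b hreg hK'on hK'c hb hper)
    have ha : a ≠ 0 := stub_axialCollar_ne_zero 𝓑 U U' K K' a b hreg hconn hU hHU hKon hKtl hU'
      hHU' hK'K hK'on hb hper
    obtain ⟨hΦon, hΦc, hΦnt, hUU', hHUU', hχon, hχeq, hχne, hχtan, hκ', hχκ⟩ :=
      stub_axialCollar_prep 𝓑 U U' K K' a b κ hU hHU hKon hKc hKne hKtan hU' hHU' hK'K hK'on hK'c
        hrot ha hb hκ hκK
    exact Theorems.ZeroEnergyRigidity.GlobalHorizonKillingField.KerrChartTransfer.stub_kerrChartTransfer 𝓑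
      (hCCH 𝓑 LorentzianMetric.isOpen_chronologicalFuture_holds_of_boundaryless
        LorentzianMetric.isOpen_chronologicalPast_holds_of_boundaryless
        PseudoRiemannianMetric.contMDiff_restrict_holds hreg hconn hvac hsc
        (a • 𝓑.killing + b • K') hΦon hΦc hper hax hΦnt (U ∩ U') ((-(b / a)) • K) (-a⁻¹)
        (-(b / a) * κ) hUU' hHUU' hχon hχeq hχne hχtan hκ' hχκ)

/-! ## Composition: the crux BY NAME from the two stubs -/

/-- **`ZeroEnergyKerrOrBomb.HawkingExtensionIsKerr` (rev 9, by name) from A and B**: B's extra hypothesis is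
A composed with the landed local defining functions of the horizon (`stub_hr_assembly`, p151777). -/
theorem HawkingExtensionIsKerr_of :
    Summit.FinalStateConjecture.FinalStateConjecture.Theses.ZeroEnergyKerrOrBomb.HawkingExtensionIsKerr := by
  intro 𝓑 _ _ hvac hreg hfut hT hsc U K hU hHU hconn hKs hKk hKc hKne hKtan hKtl hext
  refine stub_nondegenerateDock 𝓑 hvac hreg hfut hT hsc U K hU hHU hconn hKs hKk hKc hKne hKtan hKtl ?_ hext
  intro hnull htan hdeg V hV hHV
  exact stub_degenerateHorizonTurnsSpacelike 𝓑 hvac hreg hconn hsc U K hU hHU ⟨hKs, hKk⟩ hKc hKne hnull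
    htan hdeg (stub_hr_assembly 𝓑 U K hU hHU hKs hKne hnull htan) V hV hHV

end Summit.FinalStateConjecture.FinalStateConjecture.Cruxes.HawkingExtensionIsKerr.StrategistSplit

end
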